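import Literature.NumberTheory.GaloisRepresentations.CoprimeTorsionSplitting
import Literature.NumberTheory.GaloisRepresentations.LocalDualityTwoZero
import Literature.NumberTheory.GaloisRepresentations.PrimeToPEulerChar
import HarnessLib

/-!
# Tate's local Euler–Poincaré characteristic and local duality counts for a finite module of
# order prime to the residue characteristic — ALL torsion levels `n` (not only prime powers)

Let `F` be a non-archimedean local field of characteristic `0`, `n ≥ 1` an integer NOT divisible by
the residue characteristic of `F`, and `M` a finite discrete `Γ_F`-module killed by `n`.  We prove

* `natCard_one_eq_natCard_invariants_mul` — **`#H¹(F, M) = #M^{Γ_F} · #Hom_{Γ_F}(M, μₙ)`**;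
* `natCard_two_eq_natCard_invariants_homRep_of_not_dvd` — **`#H²(F, M) = #Hom_{Γ_F}(M, μₙ)`**
  (local Tate duality in bidegree `(2, 0)`, numerically; Milne I Cor. 2.3, Serre II §5.2 Thm. 2);
* `natCard_invariants_mul_natCard_two_eq_of_not_dvd` — **`#M^{Γ_F} · #H²(F, M) = #H¹(F, M)`**,
  i.e. Tate's local Euler–Poincaré characteristic `χ(Γ_F, M) = 1` in the case `(#M, p) = 1`
  (Milne, *ADT* I Thm. 2.8 with `ord_p(#M) = 0`; Serre II §5.7 Thm. 5);
* `finite_continuousCohomology_two_of_not_dvd` — `H²(F, M)` is finite.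

The tree proved these at PRIME-POWER level only: the Euler characteristic for an `ℓ`-PRIMARY module
(`natCard_invariants_mul_natCard_two_eq`, `PrimeToPEulerChar.lean`) and the `(2,0)`-count for `M`
killed by `p^k` (`natCard_two_eq_natCard_invariants_homRep`, `LocalDualityTwoZero.lean`).  This file
assembles the general case by the primary decomposition WITHOUT direct sums
(`CoprimeTorsionSplitting.lean`: for `n = ab`, `a`, `b` coprime, `#A = #A[a]·#A[b]` for every abelian
group killed by `n`, `#H^q(F, M)[a] = #H^q(F, M[a])`, `#M^Γ[a] = #M[a]^Γ`), together with

* §4 here, **`natCard_torsionBy_invariants_homRep_mu`**: `#Hom_Γ(M, μ_{ab})[a] = #Hom_Γ(M[a], μ_a)`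
  (restriction, with values in `μ_{ab}[a] = μ_a`; inverse `g ↦ (μ_a ⊆ μ_{ab}) ∘ g ∘ (e·)` for a CRT
  idempotent `e`; the tree's `muInclusion`, `muTorsionEquiv` of `LocalKummerTorsion.lean`),

and an induction on the coprime factorisation of `n` (`Nat.recOnPosPrimePosCoprime`, §5).  Consumer:
Milne I Thm. 2.6 (`LocalInvariants.UnramifiedOrthogonal`) for a perfect family at EVERY level `n`,
hence the Poitou–Tate Selmer-structure fact from Milne I 4.10(b) alone (route `SchneiderFreeAdditiveX3`
of `Summits/BirchSwinnertonDyer`).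

Everything here is PROVED; no definitions, no named facts.

## References
* J. S. Milne, *Arithmetic Duality Theorems*, 2nd ed. (2006), I Cor. 2.3, Thm. 2.8. [MilneADT2006]
* J.-P. Serre, *Galois Cohomology*, Springer (1997), II §5.2 Thm. 2, §5.7 Thm. 5. [SerreGaloisCohomology1997]
-/

noncomputable section

open CategoryTheory Function
open Field IsNonarchimedeanLocalField ValuativeRel
open scoped Valued

universe u

namespace Literature.NumberTheory.GaloisRepresentations

open _root_.TopRep _root_.ContRepresentation _root_.ContinuousCohomology DiscreteGaloisModule

/-! ### §4. `Hom_Γ(M, μ_{ab})[a] ≃ Hom_Γ(M[a], μ_a)` -/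

section Hom

variable (k : Type u) [Field k]
variable {M : Type u} [AddCommGroup M] [TopologicalSpace M] [DiscreteTopology M] [Finite M]
variable (ρ : ContinuousRep (absoluteGaloisGroup k) ℤ M) {a b : ℕ}

omit [TopologicalSpace M] [DiscreteTopology M] [Finite M] in
/-- `(μ_a ⊆ μ_n) ∘ (μ_n[a] ≃ μ_a)` is the inclusion `μ_n[a] ⊆ μ_n`. [folklore] -/
private theorem muInclusion_muTorsionEquiv {n : ℕ} (han : a ∣ n)
    (z : Submodule.torsionBy ℤ (MuCarrier k n) (a : ℤ)) :
    muInclusion k han (muTorsionEquiv k a han z) = (z : MuCarrier k n) :=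
  muVal_injective k n (by rw [muVal_muInclusion, muVal_muTorsionEquiv])

omit [DiscreteTopology M] [Finite M] in
/-- **Restriction `Hom_Γ(M, μ_n)[a] → Hom_Γ(M[a], μ_a)`**: an equivariant `f : M → μ_n` killed by `a`
takes values in `μ_n[a] = μ_a` and restricts to an equivariant `g : M[a] → μ_a` with the same values.
[folklore] -/
private theorem exists_restrict_homRep_mu {n : ℕ} (han : a ∣ n) (f : HomCarrier M (MuCarrier k n))
    (hf : ∀ (σ : absoluteGaloisGroup k) (m : M), mu k n σ (f m) = f (ρ σ m))
    (hfa : ∀ m : M, a • f m = 0) :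
    ∃ g : HomCarrier (Submodule.torsionBy ℤ M (a : ℤ)) (MuCarrier k a),
      (∀ (σ : absoluteGaloisGroup k) (x : Submodule.torsionBy ℤ M (a : ℤ)),
          mu k a σ (g x) = g (ρ.torsionRep a σ x)) ∧
        ∀ x : Submodule.torsionBy ℤ M (a : ℤ), muVal k a (g x) = muVal k n (f x) := by
  have hmem : ∀ m : M, f m ∈ Submodule.torsionBy ℤ (MuCarrier k n) (a : ℤ) := fun m =>
    (ContinuousRep.mem_torsionBy_nsmul_iff a).2 (hfa m)
  let gfun : Submodule.torsionBy ℤ M (a : ℤ) → MuCarrier k a := fun x =>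
    muTorsionEquiv k a han ⟨f x, hmem x⟩
  have hg : ∀ x, muVal k a (gfun x) = muVal k n (f x) := fun x => muVal_muTorsionEquiv k a han _
  refine ⟨HomCarrier.ofAddMonoidHom
    { toFun := gfun
      map_zero' := muVal_injective k a (by
        rw [hg, muVal_zero, Submodule.coe_zero, map_zero, muVal_zero])
      map_add' := fun x x' => muVal_injective k a (by
        rw [muVal_add, hg, hg, hg, Submodule.coe_add, map_add, muVal_add]) }, fun σ x => ?_, fun x => hg x⟩
  apply muVal_injective k a
  rw [muVal_apply, HomCarrier.ofAddMonoidHom_apply, HomCarrier.ofAddMonoidHom_apply]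
  change σ • muVal k a (gfun x) = muVal k a (gfun _)
  rw [hg, hg, ← muVal_apply, hf, ContinuousRep.subrepresentation_apply_coe]

omit [Finite M] in
/-- **Extension `Hom_Γ(M[a], μ_a) → Hom_Γ(M, μ_{ab})[a]`**: for `a`, `b` coprime, `a ≠ 0`, `M` killed by
`ab` and a CRT idempotent `e ≡ 1 (a)`, `e ≡ 0 (b)`, an equivariant `g : M[a] → μ_a` extends to the
equivariant `f = (μ_a ⊆ μ_{ab}) ∘ g ∘ (e·) : M → μ_{ab}`, killed by `a`. [folklore] -/
private theorem exists_extend_homRep_mu (ha : a ≠ 0) (hM : ∀ m : M, (a * b) • m = 0) {e : ℕ}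
    (he0 : e ≡ 0 [MOD b]) (g : HomCarrier (Submodule.torsionBy ℤ M (a : ℤ)) (MuCarrier k a))
    (hg : ∀ (σ : absoluteGaloisGroup k) (x : Submodule.torsionBy ℤ M (a : ℤ)),
      mu k a σ (g x) = g (ρ.torsionRep a σ x)) :
    ∃ f : HomCarrier M (MuCarrier k (a * b)),
      (∀ (σ : absoluteGaloisGroup k) (m : M), mu k (a * b) σ (f m) = f (ρ σ m)) ∧
        (∀ m : M, a • f m = 0) ∧
        ∀ m : M, muVal k (a * b) (f m) =
          muVal k a (g ((torsionProj ρ hM a e (dvd_mul_right a b) (div_dvd_of_modEq_zero ha he0)).hom m)) := by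
  have han : a ∣ a * b := dvd_mul_right a b
  let π := torsionProj ρ hM a e han (div_dvd_of_modEq_zero ha he0)
  refine ⟨HomCarrier.ofAddMonoidHom ((muInclusion k han).comp
    (((g : HomCarrier _ (MuCarrier k a)) : _ →+ MuCarrier k a).comp π.hom.toLinearMap.toAddMonoidHom)),
    fun σ m => ?_, fun m => ?_, fun m => rfl⟩
  · apply muVal_injective k (a * b)
    rw [muVal_apply]
    change σ • muVal k (a * b) (muInclusion k han (g (π.hom m))) =
      muVal k (a * b) (muInclusion k han (g (π.hom (ρ σ m))))
    rw [muVal_muInclusion, muVal_muInclusion, ← muVal_apply, hg σ (π.hom m),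
      ContinuousRep.hom_comm_apply π σ m]
  · change a • muInclusion k han (g (π.hom m)) = 0
    rw [← map_nsmul, ← map_nsmul, nsmul_torsionRep_eq_zero, map_zero, map_zero]

omit [TopologicalSpace M] [DiscreteTopology M] [Finite M] in
/-- An equivariant `f : M → μ_n` killed by `a` is determined by its values on `M[a]` when `M` is killed
by `ab`, `a`, `b` coprime: `f m = f (e m)` for a CRT idempotent `e`. [folklore] -/
private theorem apply_eq_apply_crt_nsmul {n e : ℕ} (he1 : e ≡ 1 [MOD a]) (f : HomCarrier M (MuCarrier k n))
    (hfa : ∀ m : M, a • f m = 0) (m : M) : f m = f (e • m) := by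
  rw [map_nsmul, nsmul_eq_self_of_modEq_one he1 (hfa m)]

/-- **`#Hom_Γ(M, μ_{ab})[a] = #Hom_Γ(M[a], μ_a)`** for `a`, `b` coprime, `a ≠ 0`, `M` killed by `ab`:
restriction (`exists_restrict_homRep_mu`) is injective (an `a`-torsion hom is determined on `M[a]`,
`apply_eq_apply_crt_nsmul`) and surjective (`exists_extend_homRep_mu`) — the Cartier dual commutes with
the primary decomposition. [cite: MilneADT2006, I §0 (M^D = Hom(M, μ))] [cite: Lang2002, Ch. I §8 Thm. 8.1] -/
theorem natCard_torsionBy_invariants_homRep_mu (hab : a.Coprime b) (ha : a ≠ 0)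
    (hM : ∀ m : M, (a * b) • m = 0) :
    Nat.card (AddSubgroup.torsionBy (ρ.homRep (mu k (a * b))).toTopRep.ρ.invariants a) =
      Nat.card ((ρ.torsionRep a).homRep (mu k a)).toTopRep.ρ.invariants := by
  classical
  obtain ⟨e, he1, he0⟩ := exists_crt_one_zero hab
  have han : a ∣ a * b := dvd_mul_right a b
  set T := AddSubgroup.torsionBy (ρ.homRep (mu k (a * b))).toTopRep.ρ.invariants a with hT
  set I := ((ρ.torsionRep a).homRep (mu k a)).toTopRep.ρ.invariants with hI
  -- unfold the two membership conditions
  have hTequiv : ∀ y : T, ∀ (σ : absoluteGaloisGroup k) (m : M),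
      mu k (a * b) σ ((y.1.1 : HomCarrier M (MuCarrier k (a * b))) m) =
        (y.1.1 : HomCarrier M (MuCarrier k (a * b))) (ρ σ m) := fun y σ =>
    (ContinuousRep.homRep_apply_eq_self_iff ρ (mu k (a * b)) σ _).1 (y.1.2 σ)
  have hTtors : ∀ y : T, ∀ m : M, a • (y.1.1 : HomCarrier M (MuCarrier k (a * b))) m = 0 := by
    intro y m
    have h0 : a • (y.1 : (ρ.homRep (mu k (a * b))).toTopRep.ρ.invariants) = 0 :=
      AddSubgroup.torsionBy.nsmul_iff.1 y.2
    have h1 : a • (y.1.1 : HomCarrier M (MuCarrier k (a * b))) = 0 := by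
      have h := congrArg Subtype.val h0
      rwa [Submodule.coe_smul_of_tower, Submodule.coe_zero] at h
    rw [← HomCarrier.nsmul_apply, h1, HomCarrier.zero_apply]
  have hIequiv : ∀ w : I, ∀ (σ : absoluteGaloisGroup k) (x : Submodule.torsionBy ℤ M (a : ℤ)),
      mu k a σ ((w.1 : HomCarrier _ (MuCarrier k a)) x) =
        (w.1 : HomCarrier _ (MuCarrier k a)) (ρ.torsionRep a σ x) := fun w σ =>
    (ContinuousRep.homRep_apply_eq_self_iff (ρ.torsionRep a) (mu k a) σ _).1 (w.2 σ)
  -- the restriction map `Φ : T → I`, through its values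
  have hΦ : ∀ y : T, ∃ w : I, ∀ x : Submodule.torsionBy ℤ M (a : ℤ),
      muVal k a ((w.1 : HomCarrier _ (MuCarrier k a)) x) =
        muVal k (a * b) ((y.1.1 : HomCarrier M (MuCarrier k (a * b))) x) := by
    intro y
    obtain ⟨g, hg, hgv⟩ := exists_restrict_homRep_mu k ρ han _ (hTequiv y) (hTtors y)
    exact ⟨⟨g, fun σ => (ContinuousRep.homRep_apply_eq_self_iff (ρ.torsionRep a) (mu k a) σ g).2
      fun x => hg σ x⟩, hgv⟩
  choose Φ hΦ using hΦ
  refine Nat.card_congr (Equiv.ofBijective Φ ⟨fun y y' hyy' => ?_, fun w => ?_⟩)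
  · -- injective: agree on `M[a]`, hence everywhere (`f m = f (e m)`)
    apply Subtype.ext; apply Subtype.ext; apply HomCarrier.ext; intro m
    have hem : e • m ∈ Submodule.torsionBy ℤ M (a : ℤ) :=
      (ContinuousRep.mem_torsionBy_nsmul_iff a).2 (nsmul_nsmul_eq_zero_of_modEq_zero he0 (hM m))
    rw [apply_eq_apply_crt_nsmul k he1 _ (hTtors y) m, apply_eq_apply_crt_nsmul k he1 _ (hTtors y') m]
    apply muVal_injective k (a * b)
    have h := hΦ y ⟨e • m, hem⟩
    have h' := hΦ y' ⟨e • m, hem⟩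
    rw [hyy'] at h
    exact h.symm.trans h'
  · -- surjective: extend `g` by `(μ_a ⊆ μ_{ab}) ∘ g ∘ (e·)`
    obtain ⟨f, hf, hfa, hfv⟩ := exists_extend_homRep_mu k ρ ha hM he0 _ (hIequiv w)
    let y : T := ⟨⟨f, fun σ => (ContinuousRep.homRep_apply_eq_self_iff ρ (mu k (a * b)) σ f).2
      fun m => hf σ m⟩, AddSubgroup.torsionBy.nsmul_iff.2 (Subtype.ext (by
        rw [Submodule.coe_smul_of_tower, Submodule.coe_zero]
        exact HomCarrier.ext fun m => by rw [HomCarrier.nsmul_apply, hfa, HomCarrier.zero_apply]))⟩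
    refine ⟨y, Subtype.ext (HomCarrier.ext fun x => muVal_injective k a ?_)⟩
    rw [hΦ y x]
    change muVal k (a * b) (f x) = _
    rw [hfv]
    congr 2
    apply Subtype.ext
    change e • (x : M) = x
    have h := congrArg Subtype.val (nsmul_eq_self_of_modEq_one he1 (nsmul_torsionRep_eq_zero a x))
    rwa [Submodule.coe_smul_of_tower] at h

end Hom

/-! ### §5. The local field: all levels `n` prime to the residue characteristic -/

section Local

variable (F : Type u) [Field F] [ValuativeRel F] [TopologicalSpace F] [IsNonarchimedeanLocalField F]
  [CharZero F]

/-- **`#H¹(F, M) = #M^{Γ_F} · #Hom_{Γ_F}(M, μₙ)` and `#H²(F, M) = #Hom_{Γ_F}(M, μₙ)` for every finite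
discrete `Γ_F`-module `M` killed by `n ≥ 1` with `char 𝓀(F) ∤ n`** — the inductive statement, by
`Nat.recOnPosPrimePosCoprime`: at a prime power `p^k` (`p ≠ char 𝓀(F)`) this is the tree's Euler
characteristic for the `p`-primary `M` (`natCard_invariants_mul_natCard_two_eq`) and `(2,0)`-count
(`natCard_two_eq_natCard_invariants_homRep`); at `n = ab` coprime all four quantities
split (`natCard_eq_mul_of_coprime`, §§2–4) and the statements for `M[a]` at level `a` and `M[b]` at
level `b` multiply. [cite: MilneADT2006, I Cor. 2.3 and Thm. 2.8] [cite: SerreGaloisCohomology1997, II §5.2 Thm. 2 and §5.7 Thm. 5] -/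
theorem natCard_one_and_two_of_not_dvd (n : ℕ) : n ≠ 0 → ¬ ringChar 𝓀[F] ∣ n →
    ∀ ⦃M : Type u⦄ [AddCommGroup M] [TopologicalSpace M] [DiscreteTopology M] [Finite M]
      (ρ : ContinuousRep (absoluteGaloisGroup F) ℤ M), (∀ m : M, n • m = 0) →
      Nat.card (continuousCohomology 1 ρ.toTopRep) =
          Nat.card ρ.toTopRep.ρ.invariants * Nat.card (ρ.homRep (mu F n)).toTopRep.ρ.invariants ∧
        Nat.card (continuousCohomology 2 ρ.toTopRep) =
          Nat.card (ρ.homRep (mu F n)).toTopRep.ρ.invariants := by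
  haveI := absoluteGaloisGroup_compactSpace F
  induction n using Nat.recOnPosPrimePosCoprime with
  | zero => exact fun h => absurd rfl h
  | one =>
    intro _ _ M _ _ _ _ ρ hM
    haveI : Subsingleton M := ⟨fun x y => by
      rw [← one_nsmul x, ← one_nsmul y, hM, hM]⟩
    haveI : Subsingleton ρ.toTopRep := ‹Subsingleton M›
    haveI := subsingleton_continuousCohomology_of_subsingleton ρ.toTopRep 0
    haveI := subsingleton_continuousCohomology_of_subsingleton ρ.toTopRep 1
    haveI : Subsingleton (HomCarrier M (MuCarrier F 1)) :=
      ⟨fun f g => HomCarrier.ext fun m => by rw [Subsingleton.elim m 0, map_zero, map_zero]⟩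
    rw [Nat.card_of_subsingleton (0 : continuousCohomology 1 ρ.toTopRep),
      Nat.card_of_subsingleton (0 : continuousCohomology 2 ρ.toTopRep),
      Nat.card_of_subsingleton (0 : ρ.toTopRep.ρ.invariants),
      Nat.card_of_subsingleton (0 : (ρ.homRep (mu F 1)).toTopRep.ρ.invariants)]
    exact ⟨rfl, rfl⟩
  | prime_pow p k hp hk =>
    intro _ hchar M _ _ _ _ ρ hM
    haveI : Fact p.Prime := ⟨hp⟩
    have hpchar : p ≠ ringChar 𝓀[F] := by
      rintro rfl
      exact hchar (dvd_pow_self _ hk.ne')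
    have hA : IsPrimaryTorsion p M := fun m => ⟨k, hM m⟩
    have hEPC := (natCard_invariants_mul_natCard_two_eq F ρ hA hpchar).2
    have h20 := (natCard_two_eq_natCard_invariants_homRep F ρ hM).2
    exact ⟨by rw [← hEPC, h20], h20⟩
  | coprime a b ha hb hab iha ihb =>
    intro _ hchar M _ _ _ _ ρ hM
    have ha0 : a ≠ 0 := by omega
    have hb0 : b ≠ 0 := by omega
    have hchara : ¬ ringChar 𝓀[F] ∣ a := fun h => hchar (h.mul_right b)
    have hcharb : ¬ ringChar 𝓀[F] ∣ b := fun h => hchar (h.mul_left a)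
    have hM' : ∀ m : M, (b * a) • m = 0 := fun m => by rw [mul_comm]; exact hM m
    -- the statements for `M[a]` at level `a` and `M[b]` at level `b`
    obtain ⟨ha1, ha2⟩ := iha ha0 hchara (ρ.torsionRep a) (nsmul_torsionRep_eq_zero a)
    obtain ⟨hb1, hb2⟩ := ihb hb0 hcharb (ρ.torsionRep b) (nsmul_torsionRep_eq_zero b)
    -- the four splittings
    have hH1 : Nat.card (continuousCohomology 1 ρ.toTopRep) =
        Nat.card (continuousCohomology 1 (ρ.torsionRep a).toTopRep) *
          Nat.card (continuousCohomology 1 (ρ.torsionRep b).toTopRep) := by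
      rw [natCard_eq_mul_of_coprime hab (nsmul_continuousCohomology_one_eq_zero _ (a * b) hM),
        natCard_torsionBy_continuousCohomology_one ρ hab ha0 hM,
        natCard_torsionBy_continuousCohomology_one ρ hab.symm hb0 hM']
    have hH2 : Nat.card (continuousCohomology 2 ρ.toTopRep) =
        Nat.card (continuousCohomology 2 (ρ.torsionRep a).toTopRep) *
          Nat.card (continuousCohomology 2 (ρ.torsionRep b).toTopRep) := by
      rw [natCard_eq_mul_of_coprime hab (nsmul_continuousCohomology_two_eq_zero _ (a * b) hM),
        natCard_torsionBy_continuousCohomology_two ρ hab ha0 hM,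
        natCard_torsionBy_continuousCohomology_two ρ hab.symm hb0 hM']
    have hH0 : Nat.card ρ.toTopRep.ρ.invariants =
        Nat.card (ρ.torsionRep a).toTopRep.ρ.invariants *
          Nat.card (ρ.torsionRep b).toTopRep.ρ.invariants := by
      have htors : ∀ v : ρ.toTopRep.ρ.invariants, (a * b) • v = 0 := fun v =>
        Subtype.ext (by rw [Submodule.coe_smul_of_tower, Submodule.coe_zero]; exact hM v)
      rw [natCard_eq_mul_of_coprime hab htors, natCard_torsionBy_invariants ρ a,
        natCard_torsionBy_invariants ρ b]
    have hHD : Nat.card (ρ.homRep (mu F (a * b))).toTopRep.ρ.invariants =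
        Nat.card ((ρ.torsionRep a).homRep (mu F a)).toTopRep.ρ.invariants *
          Nat.card ((ρ.torsionRep b).homRep (mu F b)).toTopRep.ρ.invariants := by
      have htors : ∀ f : (ρ.homRep (mu F (a * b))).toTopRep.ρ.invariants, (a * b) • f = 0 := fun f =>
        Subtype.ext (by
          rw [Submodule.coe_smul_of_tower, Submodule.coe_zero]
          exact HomCarrier.nsmul_eq_zero_of_left hM _)
      have hbpart := natCard_torsionBy_invariants_homRep_mu F ρ hab.symm hb0 hM'
      rw [mul_comm b a] at hbpart
      rw [natCard_eq_mul_of_coprime hab htors, natCard_torsionBy_invariants_homRep_mu F ρ hab ha0 hM,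
        hbpart]
    refine ⟨?_, ?_⟩
    · rw [hH1, ha1, hb1, hH0, hHD, mul_mul_mul_comm]
    · rw [hH2, ha2, hb2, hHD]

variable {M : Type u} [AddCommGroup M] [TopologicalSpace M] [DiscreteTopology M] [Finite M]

/-- **`#H¹(F, M) = #M^{Γ_F} · #Hom_{Γ_F}(M, μₙ)`** for a non-archimedean local field `F` of
characteristic `0` and a finite discrete `Γ_F`-module `M` killed by `n ≥ 1` with `char 𝓀(F) ∤ n` — the
count behind Milne I Thm. 2.6 at EVERY level `n` (Euler characteristic `χ(M) = 1` composed with the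
`(2,0)`-duality `#H²(F, M) = #H⁰(F, M^D)`). [cite: MilneADT2006, I Cor. 2.3 and Thm. 2.8]
[cite: SerreGaloisCohomology1997, II §5.2 Thm. 2 and §5.7 Thm. 5] -/
theorem natCard_one_eq_natCard_invariants_mul (n : ℕ) [NeZero n] (hn : ¬ ringChar 𝓀[F] ∣ n)
    (ρ : ContinuousRep (absoluteGaloisGroup F) ℤ M) (hM : ∀ m : M, n • m = 0) :
    Nat.card (continuousCohomology 1 ρ.toTopRep) =
      Nat.card ρ.toTopRep.ρ.invariants * Nat.card (ρ.homRep (mu F n)).toTopRep.ρ.invariants :=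
  (natCard_one_and_two_of_not_dvd F n (NeZero.ne n) hn ρ hM).1

/-- **Local Tate duality in bidegree `(2, 0)`, numerically, at EVERY level `n`**: for a
non-archimedean local field `F` of characteristic `0` and a finite discrete `Γ_F`-module `M` killed by
`n ≥ 1` with `char 𝓀(F) ∤ n`, `#H²(F, M) = #Hom_{Γ_F}(M, μₙ)` (`= #H⁰(F, M^D)`). The tree's
`natCard_two_eq_natCard_invariants_homRep` is the case `n = p^k`.
[cite: SerreGaloisCohomology1997, II §5.2 Thm. 2] [cite: MilneADT2006, I Cor. 2.3] -/
theorem natCard_two_eq_natCard_invariants_homRep_of_not_dvd (n : ℕ) [NeZero n]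
    (hn : ¬ ringChar 𝓀[F] ∣ n) (ρ : ContinuousRep (absoluteGaloisGroup F) ℤ M)
    (hM : ∀ m : M, n • m = 0) :
    Nat.card (continuousCohomology 2 ρ.toTopRep) = Nat.card (ρ.homRep (mu F n)).toTopRep.ρ.invariants :=
  (natCard_one_and_two_of_not_dvd F n (NeZero.ne n) hn ρ hM).2

/-- **Tate's local Euler–Poincaré characteristic, case `(#M, p) = 1`: `#M^{Γ_F} · #H²(F, M) = #H¹(F, M)`**
for a non-archimedean local field `F` of characteristic `0` and a finite discrete `Γ_F`-module `M`
killed by `n ≥ 1` with `char 𝓀(F) ∤ n` (so `χ(Γ_F, M) = 1`; Milne I Thm. 2.8 with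
`ord_p(#M) = 0`). The tree's `natCard_invariants_mul_natCard_two_eq` is the `ℓ`-primary case.
[cite: MilneADT2006, I Thm. 2.8] [cite: SerreGaloisCohomology1997, II §5.7 Thm. 5] -/
theorem natCard_invariants_mul_natCard_two_eq_of_not_dvd (n : ℕ) [NeZero n]
    (hn : ¬ ringChar 𝓀[F] ∣ n) (ρ : ContinuousRep (absoluteGaloisGroup F) ℤ M)
    (hM : ∀ m : M, n • m = 0) :
    Nat.card ρ.toTopRep.ρ.invariants * Nat.card (continuousCohomology 2 ρ.toTopRep) =
      Nat.card (continuousCohomology 1 ρ.toTopRep) := by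
  rw [natCard_two_eq_natCard_invariants_homRep_of_not_dvd F n hn ρ hM,
    natCard_one_eq_natCard_invariants_mul F n hn ρ hM]

/-- `H²(F, M)` is finite for `M` killed by `n ≥ 1` with `char 𝓀(F) ∤ n`. [cite: SerreGaloisCohomology1997, II §5.2 Prop. 14] -/
theorem finite_continuousCohomology_two_of_not_dvd (n : ℕ) [NeZero n] (hn : ¬ ringChar 𝓀[F] ∣ n)
    (ρ : ContinuousRep (absoluteGaloisGroup F) ℤ M) (hM : ∀ m : M, n • m = 0) :
    Finite (continuousCohomology 2 ρ.toTopRep) := by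
  apply Nat.finite_of_card_ne_zero
  rw [natCard_two_eq_natCard_invariants_homRep_of_not_dvd F n hn ρ hM]
  haveI : Finite (ρ.homRep (mu F n)).toTopRep.ρ.invariants := by
    haveI := finite_muCarrier F n
    exact Finite.of_injective _ Subtype.val_injective
  exact Nat.card_pos.ne'

end Local

end Literature.NumberTheory.GaloisRepresentations

end
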